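import Literature.MathematicalPhysics.QuantumFieldTheory.Balaban1983to89.Node00.ShearedAveragingFlat

/-!
# NODE 00 — the SHEARED average of [3] (88) on PURE GAUGES: `𝒜_j(∂g) = ∂_c(ḡ^{(j)})` — the sheared `j`-fold average of a fine pure gauge is the coarse pure gauge of its
# (79)–(80) block average (the group-level hinge behind the linearisation «`lin₁𝒜_j(∂μ) = ∂_c(blockMeanʲ μ)`»); def-free sequel of `Node00/ShearedAveragingFlat`

Cell `pub-ymgap` (HUMAN RULINGS D-0062 ∕ D-0088), seat `pub-ymgap-dag-n07-e` g19 (R141 (C) row s3 lineage; DAG node N07 = [B11]), 2026-08-28.  `--kind proof --supports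
stmt-QuantumFields-20541` (K0⁷; count-neutral).  ITEM R4 file 1b of the lineage's `STUB1-SECTF-MAP.md` § BRIDGE-92-B; the hinge named by dag-n07-w7 g0's ROAD-CHECK (cell bus
2026-08-28 I.29243 (A), HOME `pub-ymgap-dag-n07-w7/ROAD-CHECK-R4-R0prime.md`): the linearised sheared operator must intertwine fine gradients with the COARSE BLOCK MEAN that defines
print's projection `R`; THIS file proves the exact, NONLINEAR statement of which that is the derivative at `g = 1`.

THE PRINT.  [3] = T. Bałaban, *Averaging operations for lattice gauge theories*, Commun. Math. Phys. **98** (1985) 17–51 `[Balaban1985Averaging]`: (8) p. 19 `U^u(x,x′) =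
u(x)U(x,x′)u⁻¹(x′)` (so a PURE GAUGE is `1^g`, `(1^g)(x,x′) = g(x)g(x′)⁻¹`); (11) p. 19 covariance; (78)–(80) p. 30 the base-point-factored block average `R̄₀ʲ` of gauge functions;
(85)–(88) p. 31 the intrinsic factor and «the new averaging operation»; the axioms (0.5) `M({U_j⁻¹}) = M({U_j})⁻¹` and (0.6) `M({uU_jv}) = uM({U_j})v` of [Balaban1987RG1] p. 253 for
the inner operation (here: the two displayed hypotheses `hinv`, `hconj` on the block operation `𝓔`, print's `exp[mean log]` on its domain).

WHAT IS TYPED (every `Params`, every `GaugeGroup`; flat background; def-free).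
* §1 one step: `holTo_pureGauge` (`(1^g)(Γ_{y,x}) = g(emb y)g(x)⁻¹` for a contour datum trivial on `1`), `blockOp_rel_inv` ((0.5)+(0.6) ⇒ `𝓔_y{g(emb y)g(x)⁻¹} = g(emb y)·(R̄g)(y)⁻¹`),
  ★ `shearR_pureGauge` (`R̄_{0,y}(1^g) = g(emb y)·(R̄g)(y)⁻¹`), `avg_pureGauge` (`M(1^g) = 1^{g∘emb}` for an averaging with `M(1) = 1`), ★★ `shearedAvg_pureGauge` (`𝒜(1^g) = 1^{R̄g}` on `T^{(j+1)}`).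
* §3 road R0′'s NAMING ROW (r0) (plan g83 WORDS-2): ★★ `iter_eq_gaugeAct_shearRIter` ∕ `_data` — under the axial gauges below `j` and the normalisation at both ends of `c`,
  `M^j(U₁)(c) = S_j(c₋)·M^j(U′)(c)·S_j(c₊)⁻¹` (`= S_j(c₋)·V″(c)·S_j(c₊)⁻¹`): the sheared datum of road R0 written through the INTRINSIC coarse gauge `S_j(U₁)` (no `u`).
* §2 hierarchy: `iter_one` (`M^j(1) = 1`), `iter_pureGauge` (`M^j(1^g) = 1^{g↾T^{(j)}}`), ★★ `shearRIter_pureGauge` (`S_j(1^g) = g↾T^{(j)} · (R̄ʲg)⁻¹`, induction), ★★★ `shearedAvgIter_pureGauge` —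
  **`𝒜_j(1^g) = 1^{R̄ʲg}`: the sheared `j`-fold average of a fine pure gauge is the coarse pure gauge of the `j`-fold BLOCK AVERAGE of the gauge function** — so `𝒜_j` intertwines
  fine gauge functions with `R̄ʲ` (whose derivative at `1` is the `j`-fold block MEAN, print's `Q′`), not with the centre evaluation `g ↦ g↾T^{(j)}` of the plain (0.4) average.
HONEST FRAMING.  Group algebra over `Setup`; displayed hypotheses: `(av i).avg 1 = 1`, `(cd i).holTo 1 y x = 1` (true for the tree's concrete averaging ∕ staircase data, discharged by the
record instance, not here), and the two inner-operation axioms on `𝓔` stated for all site families (print imposes them on small families — the instance chooses a total extension or carries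
the guard); nothing of [3] Sect. 3 ∕ [B11] Sect. F analysis asserted; the LINEARISATION (R4 file 2) is NOT here; BRIDGE-92 stays GAP-STATED; N07 NOT discharged; count-neutral; one finite
`T⁴` programme at fixed `ε` — R4-the-rung closes `BalabanLadder.UV` only; NOT continuum ∕ ℝ⁴ ∕ OS ∕ mass gap ∕ Clay.  No `sorry`, no `def`, no `instance`, no `notation`.
-/

namespace Literature.MathematicalPhysics.QuantumFieldTheory.Balaban1983to89.Node00

open B16Sect1Backgrounds (toMS iter_gaugeAct)
open B15DeterminingSets (embIter)
open GaugeField (gaugeAct)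

variable {P : Params} {G : Type*} [GaugeGroup G]

/-! ## §1  One step -/

section OneStep

variable {j : ℕ} (cd : ContourData P j G) (𝓔 : Site P (j+1) → (Site P j → G) → G)

/-- A pure gauge read through a contour datum that is trivial on the unit configuration: `(1^g)(Γ_{y,x}) = g(emb y)·g(x)⁻¹` ([3] (8), (11) via `cd.covariant`).
[cite: Balaban1985Averaging, (8) p.19, (11) p.19] -/
theorem holTo_pureGauge (hcd1 : ∀ (y : Site P (j+1)) (x : Site P j), cd.holTo 1 y x = 1) (g : GaugeTransf P j G) (y : Site P (j+1)) (x : Site P j) :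
    cd.holTo (gaugeAct g 1) y x = g (emb y) * (g x)⁻¹ := by
  rw [cd.covariant, hcd1, mul_one]

/-- The inner-operation axioms (0.5) (inversion) and (0.6) (two-sided equivariance, here by a constant conjugation) give the base-point-relative identity
`𝓔_y{g(emb y)·g(x)⁻¹} = g(emb y)·(R̄g)(y)⁻¹`, `R̄ = gaugeAvgF 𝓔` of (78). [cite: Balaban1987RG1, (0.5)–(0.6) p.253; Balaban1985Averaging, (78) p.30] -/
theorem blockOp_rel_inv (hinv : ∀ (y : Site P (j+1)) (f : Site P j → G), 𝓔 y (fun x => (f x)⁻¹) = (𝓔 y f)⁻¹)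
    (hconj : ∀ (y : Site P (j+1)) (a : G) (f : Site P j → G), 𝓔 y (fun x => a * f x * a⁻¹) = a * 𝓔 y f * a⁻¹)
    (g : GaugeTransf P j G) (y : Site P (j+1)) :
    𝓔 y (fun x => g (emb y) * (g x)⁻¹) = g (emb y) * (gaugeAvgF 𝓔 g y)⁻¹ := by
  have hfam : (fun x => g (emb y) * (g x)⁻¹) = fun x => g (emb y) * ((g (emb y))⁻¹ * g x)⁻¹ * (g (emb y))⁻¹ := by
    funext x
    group
  rw [hfam, hconj, hinv]
  unfold gaugeAvgF
  group

/-- ★ **The intrinsic factor of a pure gauge**: `R̄_{0,y}(1^g) = 𝓔_y{(1^g)(Γ_{y,x})} = g(emb y)·(R̄g)(y)⁻¹`. [cite: Balaban1985Averaging, (85) p.31] -/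
theorem shearR_pureGauge (hcd1 : ∀ (y : Site P (j+1)) (x : Site P j), cd.holTo 1 y x = 1)
    (hinv : ∀ (y : Site P (j+1)) (f : Site P j → G), 𝓔 y (fun x => (f x)⁻¹) = (𝓔 y f)⁻¹)
    (hconj : ∀ (y : Site P (j+1)) (a : G) (f : Site P j → G), 𝓔 y (fun x => a * f x * a⁻¹) = a * 𝓔 y f * a⁻¹)
    (g : GaugeTransf P j G) (y : Site P (j+1)) :
    shearR cd 𝓔 (gaugeAct g 1) y = g (emb y) * (gaugeAvgF 𝓔 g y)⁻¹ := by
  unfold shearR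
  have h : (fun x => cd.holTo (gaugeAct g 1) y x) = fun x => g (emb y) * (g x)⁻¹ := by
    funext x
    exact holTo_pureGauge cd hcd1 g y x
  rw [h, blockOp_rel_inv 𝓔 hinv hconj g y]

/-- The average of a pure gauge is the coarse pure gauge of the centre values, for an averaging with `M(1) = 1` ([3] (11): `M(1^g) = M(1)^{g∘emb} = 1^{g∘emb}`; standing range).
[cite: Balaban1985Averaging, (11) p.19] -/
theorem avg_pureGauge (av : Averaging P j G) (hj : j + 1 ≤ P.m + P.K) (h1 : av.avg 1 = 1) (g : GaugeTransf P j G) :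
    av.avg (gaugeAct g 1) = gaugeAct (fun y => g (emb y)) 1 := by
  rw [av.covariant hj g 1, h1]

/-- ★★ **The sheared average of a pure gauge, one step**: `𝒜(1^g)(c) = (R̄g)(c₋)·(R̄g)(c₊)⁻¹ = (1^{R̄g})(c)` — the sheared average intertwines a fine gauge function with its (78) BLOCK
AVERAGE `R̄g`, not with its centre values. [cite: Balaban1985Averaging, (88) p.31, (78) p.30] -/
theorem shearedAvg_pureGauge (av : Averaging P j G) (hj : j + 1 ≤ P.m + P.K) (h1 : av.avg 1 = 1)
    (hcd1 : ∀ (y : Site P (j+1)) (x : Site P j), cd.holTo 1 y x = 1)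
    (hinv : ∀ (y : Site P (j+1)) (f : Site P j → G), 𝓔 y (fun x => (f x)⁻¹) = (𝓔 y f)⁻¹)
    (hconj : ∀ (y : Site P (j+1)) (a : G) (f : Site P j → G), 𝓔 y (fun x => a * f x * a⁻¹) = a * 𝓔 y f * a⁻¹)
    (g : GaugeTransf P j G) (c : PBond P (j+1)) :
    shearedAvg av cd 𝓔 (gaugeAct g 1) c = gaugeAct (gaugeAvgF 𝓔 g) (1 : GaugeField P (j+1) G) c := by
  unfold shearedAvg
  rw [shearR_pureGauge cd 𝓔 hcd1 hinv hconj g c.src, shearR_pureGauge cd 𝓔 hcd1 hinv hconj g c.tgt, avg_pureGauge av hj h1 g]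
  show (g (emb c.src) * (gaugeAvgF 𝓔 g c.src)⁻¹)⁻¹ * (g (emb c.src) * 1 * (g (emb c.tgt))⁻¹) * (g (emb c.tgt) * (gaugeAvgF 𝓔 g c.tgt)⁻¹)
    = gaugeAvgF 𝓔 g c.src * 1 * (gaugeAvgF 𝓔 g c.tgt)⁻¹
  rw [mul_inv_rev, inv_inv, mul_one, mul_one]
  rw [mul_assoc (gaugeAvgF 𝓔 g c.src), inv_mul_cancel_left, mul_assoc (gaugeAvgF 𝓔 g c.src), inv_mul_cancel_left]

end OneStep

/-! ## §2  The hierarchy -/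

section Hierarchy

variable (av : ∀ i, Averaging P i G) (cd : ∀ i, ContourData P i G) (𝓔 : ∀ i, Site P (i+1) → (Site P i → G) → G)

/-- `M^j(1) = 1` for a family of averagings with `M(1) = 1` at every level (Summits-side twin, not importable here: `T4Continuum/Support/SubstrateBackgroundDriven.iter_one`).
[cite: Balaban1987RG1, (0.11) p.253 (bookkeeping)] -/
theorem iter_one (h1 : ∀ i, (av i).avg 1 = 1) : ∀ j : ℕ, Averaging.iter av j (1 : GaugeField P 0 G) = 1
  | 0 => rfl
  | j + 1 => by
      show (av j).avg (Averaging.iter av j 1) = 1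
      rw [iter_one h1 j, h1]

/-- `M^j(1^g) = 1^{g↾T^{(j)}}` (r13's `iter_gaugeAct` at `U = 1`, standing range `j ≤ m + K`). [cite: Balaban1985Averaging, (11) p.19] -/
theorem iter_pureGauge (h1 : ∀ i, (av i).avg 1 = 1) {j : ℕ} (hj : j ≤ P.m + P.K) (g : GaugeTransf P 0 G) :
    Averaging.iter av j (gaugeAct g 1) = gaugeAct (toMS g j) 1 := by
  rw [iter_gaugeAct av g 1 j hj, iter_one av h1 j]

/-- ★★ **The hierarchical intrinsic factor of a pure gauge, by induction** ((85) at `U₁ = 1^g`): `S_j(1^g)(y) = g↾T^{(j)}(y) · (R̄ʲg)(y)⁻¹` — at every level `j ≤ m + K`, for averagings with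
`M(1) = 1`, contour data trivial on `1`, and a block operation with the inversion ∕ conjugation axioms. [cite: Balaban1985Averaging, (84)–(85) p.30–31] -/
theorem shearRIter_pureGauge (h1 : ∀ i, (av i).avg 1 = 1) (hcd1 : ∀ (i : ℕ) (y : Site P (i+1)) (x : Site P i), (cd i).holTo 1 y x = 1)
    (hinv : ∀ (i : ℕ) (y : Site P (i+1)) (f : Site P i → G), 𝓔 i y (fun x => (f x)⁻¹) = (𝓔 i y f)⁻¹)
    (hconj : ∀ (i : ℕ) (y : Site P (i+1)) (a : G) (f : Site P i → G), 𝓔 i y (fun x => a * f x * a⁻¹) = a * 𝓔 i y f * a⁻¹)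
    (g : GaugeTransf P 0 G) :
    ∀ (j : ℕ), j ≤ P.m + P.K → ∀ y : Site P j, shearRIter av cd 𝓔 (gaugeAct g 1) j y = toMS g j y * (gaugeAvgIter 𝓔 g j y)⁻¹
  | 0, _, y => by
      show (1 : G) = g (embIter 0 y) * (g y)⁻¹
      exact (mul_inv_cancel (g y)).symm
  | j + 1, hj, y => by
      have hj' : j ≤ P.m + P.K := Nat.le_of_succ_le hj
      have ih := shearRIter_pureGauge h1 hcd1 hinv hconj g j hj'
      -- abbreviations: `gj = g↾T^{(j)}`, `hb = R̄ʲg`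
      show shearRIter av cd 𝓔 (gaugeAct g 1) j (emb y) *
          𝓔 j y (fun x => (shearRIter av cd 𝓔 (gaugeAct g 1) j (emb y))⁻¹ * (cd j).holTo (Averaging.iter av j (gaugeAct g 1)) y x *
            shearRIter av cd 𝓔 (gaugeAct g 1) j x)
        = toMS g (j + 1) y * (gaugeAvgF (𝓔 j) (gaugeAvgIter 𝓔 g j) y)⁻¹
      have hint : (fun x => (shearRIter av cd 𝓔 (gaugeAct g 1) j (emb y))⁻¹ * (cd j).holTo (Averaging.iter av j (gaugeAct g 1)) y x *
            shearRIter av cd 𝓔 (gaugeAct g 1) j x)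
          = fun x => gaugeAvgIter 𝓔 g j (emb y) * (gaugeAvgIter 𝓔 g j x)⁻¹ := by
        funext x
        rw [ih (emb y), ih x, iter_pureGauge av h1 hj' g, holTo_pureGauge (cd j) (hcd1 j) (toMS g j) y x, mul_inv_rev, inv_inv]
        -- `(hb(e)·gj(e)⁻¹)·(gj(e)·gj(x)⁻¹)·(gj(x)·hb(x)⁻¹) = hb(e)·hb(x)⁻¹`
        simp only [mul_assoc, inv_mul_cancel_left]
      rw [hint, blockOp_rel_inv (𝓔 j) (hinv j) (hconj j) (gaugeAvgIter 𝓔 g j) y, ih (emb y), toMS_succ_apply]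
      -- `gj(e)·hb(e)⁻¹·(hb(e)·(R̄hb)(y)⁻¹) = gj(e)·(R̄hb)(y)⁻¹`
      rw [mul_assoc, inv_mul_cancel_left]

/-- ★★★ **THE HINGE, group level: `𝒜_j(1^g) = 1^{R̄ʲg}`** — the sheared `j`-fold average (88) of a fine PURE GAUGE is the coarse pure gauge of the `j`-fold (79)–(80) BLOCK AVERAGE of
the gauge function; in particular `𝒜_j` is NOT invariant under fine gauges (as the purely axial reading would make it) and does NOT read the centre values `g↾T^{(j)}` (as the plain
(0.4) average does): its derivative at `g = 1` intertwines `∂μ` with `∂_c(blockMeanʲ μ)` — print's `Q′` — which is what keeps the flat quadratic form of the heart positive (dag-n07-w7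
ROAD-CHECK (A)). [cite: Balaban1985Averaging, (88) p.31, (79)–(80) p.30] -/
theorem shearedAvgIter_pureGauge (h1 : ∀ i, (av i).avg 1 = 1) (hcd1 : ∀ (i : ℕ) (y : Site P (i+1)) (x : Site P i), (cd i).holTo 1 y x = 1)
    (hinv : ∀ (i : ℕ) (y : Site P (i+1)) (f : Site P i → G), 𝓔 i y (fun x => (f x)⁻¹) = (𝓔 i y f)⁻¹)
    (hconj : ∀ (i : ℕ) (y : Site P (i+1)) (a : G) (f : Site P i → G), 𝓔 i y (fun x => a * f x * a⁻¹) = a * 𝓔 i y f * a⁻¹)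
    (g : GaugeTransf P 0 G) {j : ℕ} (hj : j ≤ P.m + P.K) :
    shearedAvgIter av cd 𝓔 (gaugeAct g 1) j = gaugeAct (gaugeAvgIter 𝓔 g j) (1 : GaugeField P j G) := by
  funext c
  unfold shearedAvgIter
  rw [shearRIter_pureGauge av cd 𝓔 h1 hcd1 hinv hconj g j hj c.src, shearRIter_pureGauge av cd 𝓔 h1 hcd1 hinv hconj g j hj c.tgt,
    iter_pureGauge av h1 hj g]
  show (toMS g j c.src * (gaugeAvgIter 𝓔 g j c.src)⁻¹)⁻¹ * (toMS g j c.src * 1 * (toMS g j c.tgt)⁻¹) * (toMS g j c.tgt * (gaugeAvgIter 𝓔 g j c.tgt)⁻¹)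
    = gaugeAvgIter 𝓔 g j c.src * 1 * (gaugeAvgIter 𝓔 g j c.tgt)⁻¹
  rw [mul_inv_rev, inv_inv, mul_one, mul_one]
  rw [mul_assoc (gaugeAvgIter 𝓔 g j c.src), inv_mul_cancel_left, mul_assoc (gaugeAvgIter 𝓔 g j c.src), inv_mul_cancel_left]

end Hierarchy

/-! ## §3  ROAD R0′'s NAMING ROW (r0) at group level (plan g83 WORDS-2, cell bus 2026-08-28 I.29399): the plain average of the Landau copy IS the data re-gauged by the
INTRINSIC coarse gauge `S_j(U₁) = (u↾T^{(j)})⁻¹` — the shear of road R0 named without reference to `u` -/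

section Naming

variable (av : ∀ i, Averaging P i G) (cd : ∀ i, ContourData P i G) (𝓔 : ∀ i, Site P (i+1) → (Site P i → G) → G)

/-- ★★ **(r0) — «`∂_cλ = ∂_c log(u∘emb) = −∂_c log S_j(U₁)`» at group level**: under the block axial gauges of `M^i(U′)`, `i < j`, `U′ = U₁^u`, and the (81)∕(1.29) normalisation at both
ends of a bond `c` of `T^{(j)}`, the PLAIN `j`-fold average of the Landau copy is the constraint datum re-gauged by the INTRINSIC coarse gauge transformation `S_j(U₁)` ((85); `= (u↾T^{(j)})⁻¹`
there by (87)): `M^j(U₁)(c) = S_j(c₋)·M^j(U′)(c)·S_j(c₊)⁻¹ = (M^j(U′))^{S_j}(c)` — the sheared datum of road R0 (`(u∘emb)⁻¹·V″·(u∘emb)`) written as a functional of `U₁` and the data alone.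
[cite: Balaban1985Averaging, (85)–(88) p.31; Balaban1985Variational, (154) p.302] -/
theorem iter_eq_gaugeAct_shearRIter
    (h𝓔 : ∀ (i : ℕ) (y : Site P (i+1)) (f f' : Site P i → G), (∀ x, blockOf x = y → f x = f' x) → 𝓔 i y f = 𝓔 i y f')
    (hctr : ∀ (i : ℕ) (U : GaugeField P i G) (y : Site P (i+1)), (cd i).holTo U y (emb y) = 1)
    {u : GaugeTransf P 0 G} {U₁ : GaugeField P 0 G} {j : ℕ} (hj : j ≤ P.m + P.K)
    (hax : ∀ i < j, AxialGauge (cd i) (Averaging.iter av i (gaugeAct u U₁))) {c : PBond P j}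
    (hsrc : gaugeAvgIter 𝓔 u j c.src = 1) (htgt : gaugeAvgIter 𝓔 u j c.tgt = 1) :
    Averaging.iter av j U₁ c = gaugeAct (shearRIter av cd 𝓔 U₁ j) (Averaging.iter av j (gaugeAct u U₁)) c := by
  have h := shearedAvgIter_eq_iter_gauge av cd 𝓔 h𝓔 hctr hj hax hsrc htgt
  unfold shearedAvgIter at h
  show Averaging.iter av j U₁ c = shearRIter av cd 𝓔 U₁ j c.src * Averaging.iter av j (gaugeAct u U₁) c * (shearRIter av cd 𝓔 U₁ j c.tgt)⁻¹
  rw [← h]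
  group

/-- The same with the constraint datum displayed: `M^j(U′)(c) = V″(c)` ⇒ `M^j(U₁)(c) = S_j(c₋)·V″(c)·S_j(c₊)⁻¹` — road R0′'s sheared datum `V‴ = V″^{S_j(U₁)}` by name.
[cite: Balaban1985Variational, (154)–(156) p.302] -/
theorem iter_eq_gaugeAct_shearRIter_data
    (h𝓔 : ∀ (i : ℕ) (y : Site P (i+1)) (f f' : Site P i → G), (∀ x, blockOf x = y → f x = f' x) → 𝓔 i y f = 𝓔 i y f')
    (hctr : ∀ (i : ℕ) (U : GaugeField P i G) (y : Site P (i+1)), (cd i).holTo U y (emb y) = 1)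
    {u : GaugeTransf P 0 G} {U₁ : GaugeField P 0 G} {j : ℕ} (hj : j ≤ P.m + P.K)
    (hax : ∀ i < j, AxialGauge (cd i) (Averaging.iter av i (gaugeAct u U₁))) {V : GaugeField P j G} {c : PBond P j}
    (hV : Averaging.iter av j (gaugeAct u U₁) c = V c) (hsrc : gaugeAvgIter 𝓔 u j c.src = 1) (htgt : gaugeAvgIter 𝓔 u j c.tgt = 1) :
    Averaging.iter av j U₁ c = shearRIter av cd 𝓔 U₁ j c.src * V c * (shearRIter av cd 𝓔 U₁ j c.tgt)⁻¹ := by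
  rw [iter_eq_gaugeAct_shearRIter av cd 𝓔 h𝓔 hctr hj hax hsrc htgt]
  show shearRIter av cd 𝓔 U₁ j c.src * Averaging.iter av j (gaugeAct u U₁) c * (shearRIter av cd 𝓔 U₁ j c.tgt)⁻¹ = _
  rw [hV]

end Naming

end Literature.MathematicalPhysics.QuantumFieldTheory.Balaban1983to89.Node00
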